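import Summits.AtomisticToContinuum.Crystallization.Theorems.FrustratedLawDichotomySphericalLinkCert
import Summits.AtomisticToContinuum.Crystallization.Theorems.FrustratedLawDichotomyScalarBoundsPSharp

/-!
# FrustratedLawDichotomy · crux `AperiodicFrustratedLawGap` (stmt-AtomisticToContinuum-27623) — `P`'s SCALAR BOUNDS ON THE SPHERE:
# `LinkPairBound θ D₀ ρ Pat ⟸ SphericalPairBound θ c ρ Pat` (decomp-a2c, prover hand 2, gen 11)

Companion of `FrustratedLawDichotomySphericalLinkCert` (`G` on the sphere).  The four scalar single-link bounds of P (`LinkPairBound θ D₀ √3`,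
`LinkDiagonalBound θ d₀ = LinkPairBound θ d₀ √2`, fcc/hcp; p823632/p823469) quantify over twelve points with radial window `[1, 1+θ]`
(`33` parameters).  Projecting to the unit sphere with the three cosine windows of the `G` file, a bound `⟪e a, e c⟫ ≤ c` on the
directions of a pattern pair at distance `ρ` gives `‖p a − p c‖² ≥ 2 − 2c` (radii `≥ 1`, `c ≤ 1/2`), hence `LinkPairBound θ D₀ ρ` for every
`D₀ ≥ 0` with `D₀² ≤ 2 − 2c`:

* `SphericalPairBound θ c ρ Pat` — twelve unit vectors indexed by the pattern, every pair `⟪e u, e v⟫ ≤ 1 − (1+θ)⁻²/2`, contacts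
  `≥ 1 − (1+θ)²/2`, non-contacts `< (1+θ)/2` ⟹ pattern pairs at distance `ρ` have `⟪e a, e c⟫ ≤ c` [certificate target on `(S²)¹²`];
* ★ `linkPairBound_of_spherical` (`0 ≤ θ ≤ 1/2`, `c ≤ 1/2`, `D₀² ≤ 2 − 2c`);
* literals at `θ = 1/100`: `√3`-pairs with `c = −257/625` give `D₀ = 42/25` (the sharp-lens literal of `…ScalarBoundsPSharp`); square
  diagonals with `c = 7/25` give `d₀ = 6/5`;
* by name: `capForcing_hundredth_of_sphericalBounds`, `kr2Shape_of_sphericalCerts` (G and P both on the sphere, M = `CappedCert` ×2),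
  `aperiodicFrustratedLawGap_of_sphericalCerts`, `noFrustratedPeriodicMinimiser_of_sphericalCerts`.
Whether the spherical relaxation keeps the `√3` margin (`3.5θ` in coordinates at `42/25`) is a census question (min angle of `√3`-pairs over
the spherical window set vs `arccos(−257/625) ≈ 114.3°`); the diagonal side has room (`arccos(7/25) ≈ 73.7°` vs the jitterbug `≈ 78.5°`).
`[folklore]`; one definition; no `sorry`; no `instance`/`notation`.
-/

noncomputable section

namespace Summit.AtomisticToContinuum.Crystallization.Theorems.FrustratedLawDichotomySphericalPairBound

open Real RealInnerProductSpace
open Literature.Geometry.DiscreteGeometry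
open Summit.AtomisticToContinuum.Crystallization.Theses.PricedLinkCensus (ChargedEnergyGap)
open Summit.AtomisticToContinuum.Crystallization.Theorems.FrustratedLawDichotomyTwoShellRigidityCut
  (E3 CapForcing KR2Shape kr2Shape_of_cut aperiodicFrustratedLawGap_of_cut noFrustratedPeriodicMinimiser_of_cut)
open Summit.AtomisticToContinuum.Crystallization.Theorems.FrustratedLawDichotomyCappedRigidityCert (CappedCert)
open Summit.AtomisticToContinuum.Crystallization.Theorems.FrustratedLawDichotomyCappedRigidityCertPatterns (cappedRigidity_of_cert)
open Summit.AtomisticToContinuum.Crystallization.Theorems.FrustratedLawDichotomyLinkCert (linkClassification_of_linkCert)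
open Summit.AtomisticToContinuum.Crystallization.Theorems.FrustratedLawDichotomyNoTwistCert (BondLike)
open Summit.AtomisticToContinuum.Crystallization.Theorems.FrustratedLawDichotomyCapMatchOfDiagonal (LinkDiagonalBound)
open Summit.AtomisticToContinuum.Crystallization.Theorems.FrustratedLawDichotomyNoTwistOfPairBound
  (LinkPairBound linkDiagonalBound_iff_pairBound)
open Summit.AtomisticToContinuum.Crystallization.Theorems.FrustratedLawDichotomySphericalLinkCert
  (SphericalLinkCert linkCert_of_spherical norm_sub_sq_eq inner_eq_norm_mul_inner_unit inner_unit_le_of_dist_ge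
    le_inner_unit_of_dist_le inner_unit_lt_of_min_lt_dist)
open Summit.AtomisticToContinuum.Crystallization.Theorems.FrustratedLawDichotomyScalarBoundsPSharp
  (capForcing_hundredth_of_scalarBounds₁₆₈)

/-! ### §1 The statement on the sphere -/

/-- **`SphericalPairBound θ c ρ Pat`** — for twelve unit vectors `e : Pat → ℝ³` with every pair `⟪e u, e v⟫ ≤ 1 − (1+θ)⁻²/2`, pattern
contacts `⟪e u, e v⟫ ≥ 1 − (1+θ)²/2` and pattern non-contacts `⟪e u, e v⟫ < (1+θ)/2`: pattern pairs at distance `ρ` satisfy `⟪e a, e c⟫ ≤ c`.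
[certificate target on `(S²)¹²`; `ρ = √3`: the `√3`-pairs, `ρ = √2`: the square diagonals] -/
def SphericalPairBound (θ c ρ : ℝ) (Pat : Finset E3) : Prop :=
  ∀ e : ↥Pat → E3,
    (∀ u, ‖e u‖ = 1) →
    (∀ u v : ↥Pat, u ≠ v → ⟪e u, e v⟫ ≤ 1 - (1 + θ)⁻¹ ^ 2 / 2) →
    (∀ u v : ↥Pat, dist (u : E3) (v : E3) = 1 → 1 - (1 + θ) ^ 2 / 2 ≤ ⟪e u, e v⟫) →
    (∀ u v : ↥Pat, u ≠ v → dist (u : E3) (v : E3) ≠ 1 → ⟪e u, e v⟫ < (1 + θ) / 2) →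
    ∀ a b : ↥Pat, dist (a : E3) (b : E3) = ρ → ⟪e a, e b⟫ ≤ c

/-- Monotonicity in the cosine bound. [folklore] -/
theorem SphericalPairBound.mono {θ c c' ρ : ℝ} {Pat : Finset E3} (h : SphericalPairBound θ c ρ Pat) (hle : c ≤ c') :
    SphericalPairBound θ c' ρ Pat :=
  fun e h1 h2 h3 h4 a b hab => (h e h1 h2 h3 h4 a b hab).trans hle

/-! ### §2 The reduction -/

/-- **Chord from angle**: `‖x − y‖² ≥ 2 − 2c` when `⟪x/‖x‖, y/‖y‖⟫ ≤ c ≤ 1/2` and `1 ≤ ‖x‖, ‖y‖`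
(`a² + b² − 2abc − (2 − 2c) = (a − b)² + 2(1 − c)(ab − 1)`). [folklore] -/
theorem norm_sub_sq_ge_of_inner_unit_le {c : ℝ} (hc : c ≤ 1 / 2) {x y : E3} (hx1 : 1 ≤ ‖x‖) (hy1 : 1 ≤ ‖y‖)
    (h : ⟪‖x‖⁻¹ • x, ‖y‖⁻¹ • y⟫ ≤ c) : 2 - 2 * c ≤ ‖x - y‖ ^ 2 := by
  have hxpos : 0 < ‖x‖ := by linarith
  have hypos : 0 < ‖y‖ := by linarith
  have hx0 : x ≠ 0 := norm_ne_zero_iff.1 hxpos.ne'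
  have hy0 : y ≠ 0 := norm_ne_zero_iff.1 hypos.ne'
  have hin : ⟪x, y⟫ = ‖x‖ * ‖y‖ * ⟪‖x‖⁻¹ • x, ‖y‖⁻¹ • y⟫ := inner_eq_norm_mul_inner_unit hx0 hy0
  rw [norm_sub_sq_eq, hin]
  set a := ‖x‖
  set b := ‖y‖
  set κ := ⟪a⁻¹ • x, b⁻¹ • y⟫
  have hab : 0 < a * b := mul_pos hxpos hypos
  have h1 : a * b * κ ≤ a * b * c := mul_le_mul_of_nonneg_left h hab.le
  -- `a² + b² − 2abc ≥ 2 − 2c` on `[1, 3/2]²` for `c ≤ 1/2`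
  nlinarith [mul_nonneg (sub_nonneg.2 hx1) (sub_nonneg.2 hy1), mul_nonneg (sub_nonneg.2 hx1) (by linarith : (0:ℝ) ≤ 1 / 2 - c),
    mul_nonneg (sub_nonneg.2 hy1) (by linarith : (0:ℝ) ≤ 1 / 2 - c), sq_nonneg (a - b)]

/-- ★ **THE REDUCTION `SphericalPairBound θ c ρ Pat → LinkPairBound θ D₀ ρ Pat`** (`0 ≤ θ ≤ 1/2`, `c ≤ 1/2`, `D₀² ≤ 2 − 2c`).
[folklore] -/
theorem linkPairBound_of_spherical {θ c ρ D₀ : ℝ} {Pat : Finset E3} (hθ : 0 ≤ θ) (hθ1 : θ ≤ 1 / 2) (hc : c ≤ 1 / 2)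
    (hD : D₀ ^ 2 ≤ 2 - 2 * c) (hS : SphericalPairBound θ c ρ Pat) : LinkPairBound θ D₀ ρ Pat := by
  intro p hrad hinj hB0 hBc hN a c₀ hac
  have hpos : ∀ u, 0 < ‖p u‖ := fun u => lt_of_lt_of_le one_pos (hrad u).1
  have hp0 : ∀ u, p u ≠ 0 := fun u => norm_ne_zero_iff.1 (hpos u).ne'
  set e : ↥Pat → E3 := fun u => ‖p u‖⁻¹ • p u with he
  have hunit : ∀ u, ‖e u‖ = 1 := by
    intro u
    simp only [he]
    rw [norm_smul, norm_inv, norm_norm, inv_mul_cancel₀ (hpos u).ne']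
  have hmem : ∀ v, p v ∈ insert (0 : E3) (Set.range p) := fun v => Or.inr ⟨v, rfl⟩
  have hne : ∀ {u v : ↥Pat}, u ≠ v → p v ≠ p u := fun huv h => huv (hinj h).symm
  -- centre bonds: ‖p u‖ ≤ (1+θ) ‖p u − p v‖
  have hnd : ∀ {u v : ↥Pat}, u ≠ v → ‖p u‖ ≤ (1 + θ) * ‖p u - p v‖ := by
    intro u v huv
    have := (hB0 u).2 (p v) (hmem v) (hne huv)
    rwa [zero_sub, norm_neg] at this
  have hall : ∀ u v : ↥Pat, u ≠ v → ⟪e u, e v⟫ ≤ 1 - (1 + θ)⁻¹ ^ 2 / 2 := by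
    intro u v huv
    have h2 : ‖p v‖ ≤ (1 + θ) * ‖p u - p v‖ := by rw [norm_sub_rev]; exact hnd (Ne.symm huv)
    exact inner_unit_le_of_dist_ge hθ hθ1 (hrad u).1 (hrad u).2 (hrad v).1 (hrad v).2 (hnd huv) h2
  have hcon : ∀ u v : ↥Pat, dist (u : E3) (v : E3) = 1 → 1 - (1 + θ) ^ 2 / 2 ≤ ⟪e u, e v⟫ := by
    intro u v huv
    have h1 : ‖p u - p v‖ ≤ (1 + θ) * ‖p u‖ := by
      have := (hBc u v huv).1 0 (Or.inl rfl) (Ne.symm (hp0 u))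
      rwa [sub_zero] at this
    have h2 : ‖p u - p v‖ ≤ (1 + θ) * ‖p v‖ := by
      have := (hBc u v huv).2 0 (Or.inl rfl) (Ne.symm (hp0 v))
      rwa [sub_zero] at this
    exact le_inner_unit_of_dist_le (hrad u).1 (hrad v).1 h1 h2
  have hnon : ∀ u v : ↥Pat, u ≠ v → dist (u : E3) (v : E3) ≠ 1 → ⟪e u, e v⟫ < (1 + θ) / 2 :=
    fun u v huv hd => inner_unit_lt_of_min_lt_dist (hrad u).1 (hrad u).2 (hrad v).1 (hrad v).2 (hN u v huv hd)
  have hcos : ⟪e a, e c₀⟫ ≤ c := hS e hunit hall hcon hnon a c₀ hac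
  have hsq : D₀ ^ 2 ≤ ‖p a - p c₀‖ ^ 2 :=
    hD.trans (norm_sub_sq_ge_of_inner_unit_le hc (hrad a).1 (hrad c₀).1 hcos)
  exact (abs_le_of_sq_le_sq' hsq (norm_nonneg _)).2

/-! ### §3 Literals at `θ = 1/100` and the column by name -/

/-- **`√3`-pairs**: `SphericalPairBound (1/100) (−257/625) √3 Pat → LinkPairBound (1/100) (42/25) √3 Pat`
(`(42/25)² = 2 − 2·(−257/625)`; `arccos(−257/625) ≈ 114.3°`). [folklore] -/
theorem linkPairBound_sqrt3_of_spherical {Pat : Finset E3} (h : SphericalPairBound (1 / 100) (-257 / 625) (Real.sqrt 3) Pat) :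
    LinkPairBound (1 / 100) (42 / 25) (Real.sqrt 3) Pat :=
  linkPairBound_of_spherical (by norm_num) (by norm_num) (by norm_num) (by norm_num) h

/-- **Square diagonals**: `SphericalPairBound (1/100) (7/25) √2 Pat → LinkDiagonalBound (1/100) (6/5) Pat` (`(6/5)² = 2 − 2·(7/25)`;
`arccos(7/25) ≈ 73.7°`). [folklore] -/
theorem linkDiagonalBound_of_spherical {Pat : Finset E3} (h : SphericalPairBound (1 / 100) (7 / 25) (Real.sqrt 2) Pat) :
    LinkDiagonalBound (1 / 100) (6 / 5) Pat :=
  linkDiagonalBound_iff_pairBound.2 (linkPairBound_of_spherical (by norm_num) (by norm_num) (by norm_num) (by norm_num) h)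

/-- **`CapForcing (1/100)` from the four spherical pair bounds** (through the sharp-lens literal `42/25` and `6/5`). [folklore] -/
theorem capForcing_hundredth_of_sphericalBounds
    (hBf : SphericalPairBound (1 / 100) (-257 / 625) (Real.sqrt 3) fccKissingPattern)
    (hBh : SphericalPairBound (1 / 100) (-257 / 625) (Real.sqrt 3) hcpKissingPattern)
    (hDf : SphericalPairBound (1 / 100) (7 / 25) (Real.sqrt 2) fccKissingPattern)
    (hDh : SphericalPairBound (1 / 100) (7 / 25) (Real.sqrt 2) hcpKissingPattern) : CapForcing (1 / 100) :=
  capForcing_hundredth_of_scalarBounds₁₆₈ (linkPairBound_sqrt3_of_spherical hBf) (linkPairBound_sqrt3_of_spherical hBh)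
    (linkDiagonalBound_of_spherical hDf) (linkDiagonalBound_of_spherical hDh)

/-- ★ **`KR2Shape` with G AND P on the sphere**: `SphericalLinkCert(1/100)`, the four spherical pair bounds, and `CappedCert(1/100,1/20)` ×2.
[folklore] -/
theorem kr2Shape_of_sphericalCerts (hG : SphericalLinkCert (1 / 100))
    (hBf : SphericalPairBound (1 / 100) (-257 / 625) (Real.sqrt 3) fccKissingPattern)
    (hBh : SphericalPairBound (1 / 100) (-257 / 625) (Real.sqrt 3) hcpKissingPattern)
    (hDf : SphericalPairBound (1 / 100) (7 / 25) (Real.sqrt 2) fccKissingPattern)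
    (hDh : SphericalPairBound (1 / 100) (7 / 25) (Real.sqrt 2) hcpKissingPattern)
    (hMf : CappedCert (1 / 100) (1 / 20) fccKissingPattern) (hMh : CappedCert (1 / 100) (1 / 20) hcpKissingPattern) : KR2Shape :=
  kr2Shape_of_cut (linkClassification_of_linkCert (linkCert_of_spherical (by norm_num) (by norm_num) hG))
    (capForcing_hundredth_of_sphericalBounds hBf hBh hDf hDh) (cappedRigidity_of_cert hMf hMh)

/-- **`AperiodicFrustratedLawGap` (crux of item 27623) BY NAME** from `MuEquilibriumDoor ∧ ChargedEnergyGap`, G and P on the sphere, M.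
[folklore] -/
theorem aperiodicFrustratedLawGap_of_sphericalCerts
    (hDoor : Summit.AtomisticToContinuum.Crystallization.Theses.GrainCoreNetworkSplit.MuEquilibriumDoor) (hgap : ChargedEnergyGap)
    (hG : SphericalLinkCert (1 / 100))
    (hBf : SphericalPairBound (1 / 100) (-257 / 625) (Real.sqrt 3) fccKissingPattern)
    (hBh : SphericalPairBound (1 / 100) (-257 / 625) (Real.sqrt 3) hcpKissingPattern)
    (hDf : SphericalPairBound (1 / 100) (7 / 25) (Real.sqrt 2) fccKissingPattern)
    (hDh : SphericalPairBound (1 / 100) (7 / 25) (Real.sqrt 2) hcpKissingPattern)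
    (hMf : CappedCert (1 / 100) (1 / 20) fccKissingPattern) (hMh : CappedCert (1 / 100) (1 / 20) hcpKissingPattern) :
    Summit.AtomisticToContinuum.Crystallization.Theses.FrustratedLawDichotomy.AperiodicFrustratedLawGap :=
  aperiodicFrustratedLawGap_of_cut hDoor hgap (linkClassification_of_linkCert (linkCert_of_spherical (by norm_num) (by norm_num) hG))
    (capForcing_hundredth_of_sphericalBounds hBf hBh hDf hDh) (cappedRigidity_of_cert hMf hMh)

/-- **Item 26654 `NoFrustratedPeriodicMinimiser`, door-free, from the same spherical statements.** [folklore] -/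
theorem noFrustratedPeriodicMinimiser_of_sphericalCerts (hgap : ChargedEnergyGap) (hG : SphericalLinkCert (1 / 100))
    (hBf : SphericalPairBound (1 / 100) (-257 / 625) (Real.sqrt 3) fccKissingPattern)
    (hBh : SphericalPairBound (1 / 100) (-257 / 625) (Real.sqrt 3) hcpKissingPattern)
    (hDf : SphericalPairBound (1 / 100) (7 / 25) (Real.sqrt 2) fccKissingPattern)
    (hDh : SphericalPairBound (1 / 100) (7 / 25) (Real.sqrt 2) hcpKissingPattern)
    (hMf : CappedCert (1 / 100) (1 / 20) fccKissingPattern) (hMh : CappedCert (1 / 100) (1 / 20) hcpKissingPattern) :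
    Summit.AtomisticToContinuum.Crystallization.Theses.PeriodicChargeSplit.NoFrustratedPeriodicMinimiser :=
  noFrustratedPeriodicMinimiser_of_cut hgap (linkClassification_of_linkCert (linkCert_of_spherical (by norm_num) (by norm_num) hG))
    (capForcing_hundredth_of_sphericalBounds hBf hBh hDf hDh) (cappedRigidity_of_cert hMf hMh)

end Summit.AtomisticToContinuum.Crystallization.Theorems.FrustratedLawDichotomySphericalPairBound

end
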